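import Summits.NavierStokesRegularity.NavierStokesRegularity.Theorems.PalasekTowerBreakdownEpisodeBaseSliceExplicit

/-! # BC3 skeleton v5 for the crux `EpisodeBase` (= `EpisodeBaseG`, register v2.3′) — line `slot`, EXPLICIT LETTER

Holder of record ns-palasek-19179-p2 (g2), 2026-08-27, adopting ecbridge-4 g5's turnkey draft
`HOME/ecbridge4/g5/EpisodeBase_explicit_v5_draft.lean` (sha16 62a0d30d8a9b33b5) VERBATIM below this header, on refuter4's
recommendation K94 (2) (STATUS l.5533): the v4 stub `stub_slot_pushed_levelWitness : SlotPushedLevelWitness` (skeleton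
6becc362f8ae9286, `∃ U ρ c₄ (h : Germ.LevelZeroData U ρ) …, PushedLevelWitness (h.schedule c₄ …)`) quantifies over the germ
schedule `h.schedule c₄`, whose width `σ₀ = h.width` and fade length `ε = h.fadeLen` are `Classical.choose` constants — so every
feeder of the v4 letter evaluates a window run under a force with opaque parameters, and no certified integration can target it
except uniformly over the spec range (K91/K94). RESHAPED STUB (same line, same composition idea «strict-slot filler + ONE window
run», every design parameter NAMED):

* `stub_explicit_slice_run : ExplicitSliceRun` — SOME explicit germ design `(U, ρ, σ₀, ε, c₄)` filling ecbridge-3 g3's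
  certificate slot `Germ.LineGermData U ρ σ₀ ε c₄` (p-GermHostExplicit: level-`0` readouts of `U`, the LINE ANCHOR at width
  `σ₀`, the residual bound `≤ c₄Y₀` on the fade window `[1, 1 + ε]`, `0 < c₄ ≤ 1` — closed-form statements about `U` and four
  numbers), and SOME classical finite-energy solution `(v, q)` of Navier–Stokes at unit viscosity on the first growth window
  `[1, Host.τfirst]` (`τ₀ = 1`, `τfirst = 1 + 4bβ log N₁/A₀`) forced by the design's own faded residual `lineForce U σ₀ ε`,
  STARTING FROM `v 1 = U`, below `(5/3)·Y₁` throughout, showing at `Host.τfirst` in `B̄(0, ρ)` the speed floor `Y₁`, the strain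
  floor `A₁` and an `N₁`-core loop of circulation `≥ N₁^{β−2}`.

The composition `EpisodeBase_of` is ecbridge-4 g5's landed by-name door
`Theorems.palasekTowerBreakdown_episodeBase_of_exists_lineGerm_selfRun` (p472431,
`Theorems/PalasekTowerBreakdownEpisodeBaseSliceExplicit.lean`: host preparation = `LineGermData.hostPreparationD_exact`, the
host's slice identified with `U` by forced Serrin–Masuda, the run glued to the line germ at `t = 1`, pins / rigidity / quietness
of `Schedule.ofBox`, the level-`1` letter read into the register). RELATION TO v4 (one direction each, by name): an explicit `d`
with a self-run gives the v4 letter's unpushed feeder (`LevelZeroData.schedule_eq` is the `∃(σ₀, ε)` shadow, K91), and the v4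
letter is provable only THROUGH some explicit `d` (`h.lineGermData`); the pushed variant of this letter is the sibling door
`…_of_exists_lineGerm_pushedRun` (not registered: the window push has authority `forceAnch·Y₀³ = Y₀`, impulse `≤ 1/4`, i.e.
`5.48·10⁻⁷` in unit-speed terms — `FluidComputer/PalasekTowerFaceNumbers`). What the stub asks of a design, in certified pure
numbers (`Theorems/PalasekTowerBreakdownEpisodeBaseFacesUnit`, this seat): a unit-speed finite-energy classical flow, essentially
unforced, whose maximal speed exceeds `2.055` after `windowAnch ∈ (325.7, 325.9)` viscous times under the running cap `3.429`,
with gradient `> 0.0577·M²` in ceiling units and the core letter at the same instant. Lines of record: v1 c9e75b33 (g16) / v2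
448935b8 (g17, `Lines/birth.lean`) / v3 844b5160 (g18; stub misstated, #37/#42) / v4 6becc362 (this base g0; superseded by this
reshape, not refuted). Cell `ns-blowup`. WHAT THIS IS NOT: not Navier–Stokes evidence — a skeleton; the stub is OPEN and carries
a `sorry`; nothing is asserted about any flow after `τ₀`, about `RungG 1` or blow-up. -/

noncomputable section

namespace Summit.NavierStokesRegularity.FluidComputer.PalasekTowerClayBridge.ExplicitEpisodeBaseG

open Set MeasureTheory
open scoped ENNReal
open Literature.Analysis.FluidPDE
open Summit.NavierStokesRegularity.FluidComputer.PalasekTowerClayBridge.Germ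

/-- **Stub statement of the line `slot`, v5 (explicit letter)**: SOME explicit germ design `(U, ρ, σ₀, ε, c₄)` filling
`Germ.LineGermData`, and SOME classical finite-energy solution `(v, q)` of Navier–Stokes at unit viscosity on the first
growth window `[1, Host.τfirst]` forced by `lineForce U σ₀ ε`, STARTING FROM `U`, below `(5/3) Y₁`, showing at
`Host.τfirst` in `B̄(0, ρ)` the speed floor `Y₁`, the strain floor `A₁` and an `N₁`-core loop. [cite: Palasek2026ElementaryModel, §4] -/
def ExplicitSliceRun : Prop :=
  ∃ (U : EuclideanSpace ℝ (Fin 3) → EuclideanSpace ℝ (Fin 3)) (ρ σ₀ ε c₄ : ℝ) (_ : LineGermData U ρ σ₀ ε c₄)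
    (v : ℝ → EuclideanSpace ℝ (Fin 3) → EuclideanSpace ℝ (Fin 3)) (q : ℝ → EuclideanSpace ℝ (Fin 3) → ℝ),
    IsClassicalNSSolutionOn (Icc 1 Host.τfirst) 1 (lineForce U σ₀ ε) v q ∧ v 1 = U ∧
    (∃ C : ℝ≥0∞, C < ⊤ ∧ ∀ t ∈ Icc (1 : ℝ) Host.τfirst, ∫⁻ x, ‖v t x‖ₑ ^ 2 ≤ C) ∧
    (∀ t ∈ Icc (1 : ℝ) Host.τfirst, ∀ x, ‖v t x‖ ≤ 5 / 3 * TowerRates.wide.Y 1) ∧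
    (∃ x, ‖x‖ ≤ ρ ∧ TowerRates.wide.Y 1 ≤ ‖v Host.τfirst x‖) ∧
    (∃ x, ‖x‖ ≤ ρ ∧ TowerRates.wide.A 1 ≤ ‖fderiv ℝ (v Host.τfirst) x‖) ∧
    (∃ (x : EuclideanSpace ℝ (Fin 3)) (γ : ℝ → EuclideanSpace ℝ (Fin 3)),
      ‖x‖ ≤ ρ ∧ ContDiff ℝ 1 γ ∧ γ 0 = γ 1 ∧
      (∀ s ∈ Icc (0 : ℝ) 1, γ s ∈ Metric.closedBall x (1 / TowerRates.wide.N 1)) ∧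
      (∀ s ∈ Icc (0 : ℝ) 1, ‖deriv γ s‖ ≤ 8 * Real.pi / TowerRates.wide.N 1) ∧
      TowerRates.wide.N 1 ^ (TowerRates.wide.β - 2) ≤ circulation (v Host.τfirst) γ)

/-- registered stub (OPEN — the mechanism): one explicit design and one certified window run from its profile. -/
theorem stub_explicit_slice_run : ExplicitSliceRun := by
  sorry

/-- The composition: the landed by-name explicit door. [cite: Palasek2026ElementaryModel, §4] -/
theorem EpisodeBase_of : ExplicitSliceRun →
    Summit.NavierStokesRegularity.NavierStokesRegularity.Theses.PalasekTowerBreakdown.EpisodeBase :=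
  Summit.NavierStokesRegularity.NavierStokesRegularity.Theorems.palasekTowerBreakdown_episodeBase_of_exists_lineGerm_selfRun

/-- The hypothesis-free skeleton line (carries the stub's `sorry`). -/
theorem EpisodeBase_skeleton :
    Summit.NavierStokesRegularity.NavierStokesRegularity.Theses.PalasekTowerBreakdown.EpisodeBase :=
  EpisodeBase_of stub_explicit_slice_run

end Summit.NavierStokesRegularity.FluidComputer.PalasekTowerClayBridge.ExplicitEpisodeBaseG

end
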